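import Summits.BirchSwinnertonDyer.BirchSwinnertonDyer.Theorems.KimAtThreeStubOfPinned
import Summits.BirchSwinnertonDyer.BirchSwinnertonDyer.Theorems.KimAtThreeStubDualSaturation
import Literature.NumberTheory.GaloisCohomology.Sakamoto2024KolyvaginRankOne
import HarnessLib

/-!
# Route `KimAtThreeKolyvagin` (rung W2), crux `StubAtEmptyLevelThree` (item 19561): PROPORTIONALITY AND
# LIFTABILITY AT A GOOD CORE VERTEX from [S24] Thm. 4.4 (1) pinned — no pair count at transverse levels

Cell `bsd-addord`, seat `bsd-addord-w2-c5` (gen 3). TOOL FILE: theorems only, no definition, no named fact, no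
`sorry`; closes nothing; books nothing. HONEST FRAMING: BSD is not proved by any of this; item 19561 stays OPEN
(aside); CONDITIONAL on the PUBLISHED pinned fact `Sakamoto2024.kolyvaginSystems_freeRankOne_zmod_three_pow`.

This file replaces inputs (L-a) and (L-c) of w2-c2 gen 3's liftability road (`KimAtThreeStubLiftability`,
`KimAtThreeStubCoreVertex.exists_coreVertex_map_red_eq_smul`) — there obtained from the S24-DEEP port and from
[S24] Thm. 4.4 (2) in order form PLUS Poitou–Tate pair counts AT EVERY LEVEL of two data — by the following
port-free and pair-count-free mechanism: at a GOOD CORE VERTEX `c` (w2-c4's `exists_superset_kummerSelmerGroup_eq_bot…`,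
residual Kummer currency) evaluation `κ ↦ κ_c` is a BIJECTION `KS₁ → H¹_{𝓕(c)}` at both depths ([S24] (1),
bijectivity clause), so an ℕ-generator has full order at `c` (`addOrderOf_apply_eq_rat_three_deep`) and
`red_*(g̃_c) ∈ H¹_{𝓕_can^{(k)}(c)} = ℕ•g_c` is a multiple `w•g_c` by SURJECTIVITY, with `3 ∤ w` by the order
count; rigidity on the deep class is this seat's `kolyvaginSystems_freeRankOne_deep_of_pinned_of_towerSurj`.

* `zmultiples_mk_eq_top_of_forall_eq_nsmul`, `eq_pow_of_mul_eq_mul_pow` — algebra.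
* `dual_exponent_eq_of_orders_of_le` — w2-c2's `dual_exponent_eq_of_orders` (Mazur–Rubin Lemma 4.1.1 (ii) from
  ORDERS) with its a-priori bound `n_t ≤ j` REMOVED; `dual_exponent_eq_of_orders_lift` — the same comparison
  read downwards (the exponent known at the lift level).
* `pow_nsmul_map_red_eq_zero_iff` — `3^a · red_* y = 0 ↔ 3^{a+(k̃−k)} · y = 0` under surj(3).
* ★ `exists_proportional_lift_of_goodCoreVertex` — for data `D ⊇ D̃` (levels `k ≤ k̃`, `D̃` on the deep class,
  cyclotomic transverse conditions, canonical comparison maps for one `η`), an ℕ-generator `g` of `KS₁(D)`, a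
  Kolyvagin system `g̃` of `D̃`, and a level `c` of `D̃` at which evaluation on `KS₁(D)` is bijective and `g_c`,
  `g̃_c` have full order: `red_*(g̃_∅) = w • g_∅` with `w` prime to `3`, and `g_∅` LIFTS to `H¹_{𝓕_can}(ℚ, E[3^{k̃+1}])`.

References: [MazurRubin2004] Lemma 4.1.1, Thm. 4.4.1, Thm. 4.4.3 (pp. 35–47); [Sakamoto2024] Thm. 4.4 (1)
(p. 926); [Rubin2011] Thm. 2.8.4.
-/

set_option autoImplicit false
-- the Theorems namespace of a single-conjunct summit repeats the summit name by design (D-0017)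
set_option linter.dupNamespace false

noncomputable section

open scoped Classical NumberField ContRepresentation
open Function Field NumberField IsDedekindDomain WeierstrassCurve Literature.NumberTheory.EllipticCurves
  Literature.NumberTheory.GaloisRepresentations Literature.NumberTheory.GaloisRepresentations.DiscreteGaloisModule
  Literature.NumberTheory.GaloisCohomology Literature.NumberTheory.GaloisCohomology.KolyvaginDatum
  Summit.BirchSwinnertonDyer.Rank1Residual.GaloisImage Summit.BirchSwinnertonDyer.Rank1Residual.GaloisImage.Transport

namespace Summit.BirchSwinnertonDyer.BirchSwinnertonDyer.Theorems.KimAtThreeStubOfLiftable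

/-! ### §1 Algebra -/

/-- An ℕ-generator of an additive subgroup is a `zmultiples`-basis of it. [folklore] -/
theorem zmultiples_mk_eq_top_of_forall_eq_nsmul {A : Type*} [AddCommGroup A] {X : AddSubgroup A} {g : A}
    (hg : g ∈ X) (hgen : ∀ κ ∈ X, ∃ a : ℕ, κ = a • g) :
    AddSubgroup.zmultiples (⟨g, hg⟩ : X) = ⊤ := by
  rw [eq_top_iff]
  rintro κ -
  obtain ⟨a, ha⟩ := hgen κ.1 κ.2
  exact ⟨a, Subtype.ext (by push_cast; rw [natCast_zsmul]; exact ha.symm)⟩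

/-- A power of `3` count from a pair count: `3^{i} · n = 3^{i} · 3^{m}` gives `n = 3^m`. [folklore] -/
theorem eq_pow_of_mul_eq_mul_pow {i n m : ℕ} (h : 3 ^ i * n = 3 ^ i * 3 ^ m) : n = 3 ^ m :=
  Nat.eq_of_mul_eq_mul_left (pow_pos (by norm_num) i) h

/-- **Dual saturation from orders, without the a-priori bound on the lift exponent.** Abstract levels
`j ≤ k̃` with gap `g`, `φ = red_*` with `3^a • φ(y_t) = 0 ↔ 3^{a+g} • y_t = 0`; the proportionality
`φ y_t = w • y_j` with `w` prime to `3`; `3^{j+1} • y_j = 0` and `ord(y_j) = 3^{j+1−n_j}` with `n_j ≤ j`; and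
[S24] Thm. 4.4 (2) at the lift level in the two-clause ORDER form for `n_t = log₃ #N_{k̃}`. Then `n_t = n_j`.
[cite: MazurRubin2004, Lemma 4.1.1 (ii) (p. 35) and Thm. 4.4.3 (p. 47)] [cite: Sakamoto2024, Thm. 4.4 (2) (p. 926)] -/
theorem dual_exponent_eq_of_orders_of_le {A B : Type*} [AddCommGroup A] [AddCommGroup B] (φ : B →+ A)
    {j kt g nt nj : ℕ} (hg : j + g = kt) (hnj : nj ≤ j)
    {yt : B} {yj : A} {w : ℤ} (hw : IsCoprime w 3)
    (hker : ∀ a : ℕ, 3 ^ a • φ yt = 0 ↔ 3 ^ (a + g) • yt = 0)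
    (hcmp : φ yt = w • yj) (hkill : 3 ^ (j + 1) • yj = 0)
    (hordj : addOrderOf yj = 3 ^ (j + 1 - nj))
    (h1t : nt ≤ kt + 1 → addOrderOf yt * 3 ^ nt = 3 ^ (kt + 1))
    (h2t : kt + 1 ≤ nt → yt = 0) : nt = nj := by
  -- `3^a • yj = 0 ↔ j + 1 - nj ≤ a`
  have keyj : ∀ a : ℕ, 3 ^ a • yj = 0 ↔ j + 1 - nj ≤ a := fun a =>
    pow_nsmul_eq_zero_iff_of_addOrderOf_eq Nat.prime_three hordj a
  have hyj : yj ≠ 0 := by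
    intro h
    have := (keyj 0).mp (by rw [h, smul_zero])
    omega
  -- `yt ≠ 0`, so `nt ≤ kt` and clause 1 applies
  have hyt : yt ≠ 0 := by
    intro h
    apply hyj
    have h0 : w • yj = 0 := by rw [← hcmp, h, map_zero]
    have h1 : 3 ^ 0 • yj = 0 :=
      (nsmul_eq_zero_iff_of_isCoprime hw hkill 0).mp (by rw [pow_zero, one_smul]; exact h0)
    rwa [pow_zero, one_smul] at h1
  have hnt : nt ≤ kt := by
    by_contra hlt
    exact hyt (h2t (by omega))
  have hordt : addOrderOf yt = 3 ^ (kt + 1 - nt) := by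
    have h := h1t (by omega)
    have hsplit : 3 ^ (kt + 1) = 3 ^ (kt + 1 - nt) * 3 ^ nt := by
      rw [← pow_add, Nat.sub_add_cancel (by omega)]
    rw [hsplit] at h
    exact Nat.eq_of_mul_eq_mul_right (pow_pos (by norm_num) _) h
  -- `3^a • yj = 0 ↔ kt + 1 - nt ≤ a + g`
  have keyt : ∀ a : ℕ, 3 ^ a • yj = 0 ↔ kt + 1 - nt ≤ a + g := by
    intro a
    rw [← nsmul_eq_zero_iff_of_isCoprime hw hkill a, ← hcmp, hker a,
      pow_nsmul_eq_zero_iff_of_addOrderOf_eq Nat.prime_three hordt]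
  have h1 := (keyj (j + 1 - nj)).mpr le_rfl
  rw [keyt] at h1
  have h2 := (keyt (kt + 1 - nt - g)).mpr (by omega)
  rw [keyj] at h2
  omega

/-- **Dual saturation read downwards.** `φ = red′_*` from the lift level `k̃` to a level `m` with gap `g`
(`3^a • φ y_t = 0 ↔ 3^{a+g} • y_t = 0`), `φ y_t = w • y_m` with `w` prime to `3`, `3^{m+1} • y_m = 0`,
`ord(y_t) = 3^{k̃+1−n₀}` with `n₀ ≤ m`, and [S24] Thm. 4.4 (2) at level `m` in the two-clause order form for
`n_m`: then `n_m = n₀`. [cite: MazurRubin2004, Lemma 4.1.1 (ii) (p. 35)] [cite: Sakamoto2024, Thm. 4.4 (2) (p. 926)] -/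
theorem dual_exponent_eq_of_orders_lift {A B : Type*} [AddCommGroup A] [AddCommGroup B] (φ : B →+ A)
    {m kt g n₀ nm : ℕ} (hg : m + g = kt) (hn₀ : n₀ ≤ m)
    {yt : B} {ym : A} {w : ℤ} (hw : IsCoprime w 3)
    (hker : ∀ a : ℕ, 3 ^ a • φ yt = 0 ↔ 3 ^ (a + g) • yt = 0)
    (hcmp : φ yt = w • ym) (hkill : 3 ^ (m + 1) • ym = 0)
    (hordt : addOrderOf yt = 3 ^ (kt + 1 - n₀))
    (h1m : nm ≤ m + 1 → addOrderOf ym * 3 ^ nm = 3 ^ (m + 1))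
    (h2m : m + 1 ≤ nm → ym = 0) : nm = n₀ := by
  have hkey : ∀ a : ℕ, 3 ^ a • ym = 0 ↔ kt + 1 - n₀ ≤ a + g := by
    intro a
    rw [← nsmul_eq_zero_iff_of_isCoprime hw hkill a, ← hcmp, hker a,
      pow_nsmul_eq_zero_iff_of_addOrderOf_eq Nat.prime_three hordt]
  have hym : ym ≠ 0 := by
    intro h
    have := (hkey 0).mp (by rw [h, smul_zero])
    omega
  have hnm_le : nm ≤ m := by
    by_contra hlt
    exact hym (h2m (by omega))
  have hordm : addOrderOf ym = 3 ^ (m + 1 - nm) := by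
    have h := h1m (by omega)
    have hsplit : 3 ^ (m + 1) = 3 ^ (m + 1 - nm) * 3 ^ nm := by
      rw [← pow_add, Nat.sub_add_cancel (by omega)]
    rw [hsplit] at h
    exact Nat.eq_of_mul_eq_mul_right (pow_pos (by norm_num) _) h
  have h1 := (hkey (m + 1 - nm)).mp
    ((pow_nsmul_eq_zero_iff_of_addOrderOf_eq Nat.prime_three hordm _).mpr le_rfl)
  have h2 : ¬ 3 ^ (m - nm) • ym = 0 := fun h => by
    have := (pow_nsmul_eq_zero_iff_of_addOrderOf_eq Nat.prime_three hordm _).mp h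
    omega
  rw [hkey] at h2
  omega

/-! ### §2 `3^a • red_* y = 0 ↔ 3^{a + (k̃ − k)} • y = 0` -/

/-- **The kernel clause of the liftability algebra** (Mazur–Rubin Lemma 4.1.1 (i) in order form): under
surj(3), for the reduction `red : E[3^{k̃}·3] → E[3^k·3]` (`x ↦ 3^{k̃−k}x`) and any class `y`,
`3^a • red_* y = 0 ↔ 3^{a+(k̃−k)} • y = 0` (`incl_* ∘ red_* = 3^{k̃−k}` and `incl_*` is injective because
`E(ℚ)[3] = 0`). [cite: MazurRubin2004, Lemma 4.1.1 (i) (p. 35)] -/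
theorem pow_nsmul_map_red_eq_zero_iff (W : WeierstrassCurve ℚ) [W.IsElliptic]
    (hsurj : W.HasSurjectiveModNGaloisRep ((3 : ℕ) : ℤ)) {k kt : ℕ} (hkk : k ≤ kt)
    (red : (W.torsionGaloisModule (((3 : ℕ) : ℤ) ^ kt * ((3 : ℕ) : ℤ))).toContRepresentation →ⁱL
      (W.torsionGaloisModule (((3 : ℕ) : ℤ) ^ k * ((3 : ℕ) : ℤ))).toContRepresentation)
    (hred : ∀ x : geomTorsion W (((3 : ℕ) : ℤ) ^ kt * ((3 : ℕ) : ℤ)),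
      ((red x : geomTorsion W (((3 : ℕ) : ℤ) ^ k * ((3 : ℕ) : ℤ))) : geomPoints W) =
        (((3 : ℕ) : ℤ) ^ (kt - k)) • (x : geomPoints W))
    (y : galoisCohomology (W.torsionGaloisModule (((3 : ℕ) : ℤ) ^ kt * ((3 : ℕ) : ℤ))) 1) (a : ℕ) :
    3 ^ a • galoisCohomology.map red 1 y = 0 ↔ 3 ^ (a + (kt - k)) • y = 0 := by
  have hinj : Function.Injective
      (galoisCohomology.map (W.torsionInclusion (pow_mul_dvd_pow_mul hkk)) 1) :=
    map_torsionInclusion_injective W hkk (geomTorsion_eq_zero_of_fixed_of_surj W hsurj kt)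
  constructor
  · intro h
    have h' := congrArg (galoisCohomology.map (W.torsionInclusion (pow_mul_dvd_pow_mul hkk)) 1) h
    rw [map_nsmul, map_zero, map_torsionInclusion_map_red W hkk red hred y, ← mul_nsmul', ← pow_add] at h'
    exact h'
  · intro h
    apply hinj
    rw [map_nsmul, map_zero, map_torsionInclusion_map_red W hkk red hred y, ← mul_nsmul', ← pow_add]
    exact h

/-! ### §3 Proportionality and liftability at a good core vertex -/

/-- **(L-a) + (L-c) ⟹ liftability, at a GOOD CORE VERTEX, from [S24] Thm. 4.4 (1) pinned** (module
docstring). Levels `1 ≤ k ≤ k̃`, the reduction `red` (`x ↦ 3^{k̃−k}x`), surj(3) from the tower; a datum `D` on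
`E[3^k·3]` and a datum `D̃` on `E[3^{k̃}·3]` over the DEEP class `frobeniusClassPrimes (E[3^{k̃}·3]) S τ 3^{k̃+1}
⊆ 𝒫(D)`, both with cyclotomic transverse conditions and canonical comparison maps for one `η`; an ℕ-generator
`g` of `KS₁(D)` and a Kolyvagin system `g̃` of `D̃`; a level `c` of `D̃` at which `κ ↦ κ_c` is bijective on
`KS₁(D)` and `g_c`, `g̃_c` have full order `3^{k+1}`, `3^{k̃+1}`. THEN `red_*(g̃_∅) = w • g_∅` for some `w`
prime to `3`, and `g_∅ = red_* y` for some `y ∈ H¹_{𝓕_can}(ℚ, E[3^{k̃+1}])`.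
[cite: MazurRubin2004, Thm. 4.4.3 (pp. 46–47) and Thm. 4.4.1 (p. 45)] [cite: Sakamoto2024, Thm. 4.4 (1) (p. 926)] -/
theorem exists_proportional_lift_of_goodCoreVertex
    (hS24 : Sakamoto2024.kolyvaginSystems_freeRankOne_zmod_three_pow)
    (W : WeierstrassCurve ℚ) [W.IsElliptic] [Finite (geomTorsion W ((3 : ℕ) : ℤ))]
    (htower : ∀ n : ℕ, W.HasSurjectiveModNGaloisRep (3 ^ n : ℕ)) {k kt : ℕ} (hk : 1 ≤ k) (hkk : k ≤ kt)
    [Finite (geomTorsion W (((3 : ℕ) : ℤ) ^ k * ((3 : ℕ) : ℤ)))]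
    [Finite (geomTorsion W (((3 : ℕ) : ℤ) ^ kt * ((3 : ℕ) : ℤ)))]
    (red : (W.torsionGaloisModule (((3 : ℕ) : ℤ) ^ kt * ((3 : ℕ) : ℤ))).toContRepresentation →ⁱL
      (W.torsionGaloisModule (((3 : ℕ) : ℤ) ^ k * ((3 : ℕ) : ℤ))).toContRepresentation)
    (hred : ∀ x : geomTorsion W (((3 : ℕ) : ℤ) ^ kt * ((3 : ℕ) : ℤ)),
      ((red x : geomTorsion W (((3 : ℕ) : ℤ) ^ k * ((3 : ℕ) : ℤ))) : geomPoints W) =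
        (((3 : ℕ) : ℤ) ^ (kt - k)) • (x : geomPoints W))
    (τ : absoluteGaloisGroup ℚ) (hτμ : τ ∈ rootsOfUnityFixer ℚ (3 ^ (kt + 1)))
    (hτq : Nonempty (cokerSubOne (W.torsionGaloisModule (((3 : ℕ) : ℤ) ^ kt * ((3 : ℕ) : ℤ))) τ ≃+
      ZMod (3 ^ (kt + 1))))
    (inv₃ : LocalInvariants ℚ 3) (hperf₃ : inv₃.IsPerfect) (hsum₃ : inv₃.SumLocalTermEqZero)
    (hcompl₃ : inv₃.SelmerComplement)
    (hEP : ∀ v : HeightOneSpectrum (𝓞 ℚ), localEulerPoincareCharacteristic (v.adicCompletion ℚ))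
    {S : Finset (Place ℚ)} (hS : ∀ w : InfinitePlace ℚ, (Sum.inl w : Place ℚ) ∈ S)
    (h3S : ∀ v : HeightOneSpectrum (𝓞 ℚ), ((3 : ℕ) : 𝓞 ℚ) ∈ v.asIdeal → (Sum.inr v : Place ℚ) ∈ S)
    (hbadS : ∀ v : HeightOneSpectrum (𝓞 ℚ), ¬ W.HasGoodReductionAt v → (Sum.inr v : Place ℚ) ∈ S)
    {η : (q : HeightOneSpectrum (𝓞 ℚ)) → (ZMod (Ideal.absNorm q.asIdeal))ˣ}
    -- the two data
    {D : KolyvaginDatum (W.torsionGaloisModule (((3 : ℕ) : ℤ) ^ k * ((3 : ℕ) : ℤ)))}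
    {Dt : KolyvaginDatum (W.torsionGaloisModule (((3 : ℕ) : ℤ) ^ kt * ((3 : ℕ) : ℤ)))}
    (hT : D.transverse = cyclotomicTransverse _) (hD : D.HasCanonicalComparison (3 ^ (k + 1)) η)
    (hPt : Dt.primes = frobeniusClassPrimes
      (W.torsionGaloisModule (((3 : ℕ) : ℤ) ^ kt * ((3 : ℕ) : ℤ))) {v | (Sum.inr v : Place ℚ) ∈ S} τ (3 ^ (kt + 1)))
    (hsub : Dt.primes ⊆ D.primes)
    (hTt : Dt.transverse = cyclotomicTransverse _) (hDt : Dt.HasCanonicalComparison (3 ^ (kt + 1)) η)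
    -- the ℕ-generator `g` of `KS₁(D)` and the Kolyvagin system `g̃` of `D̃`
    {g : Finset (HeightOneSpectrum (𝓞 ℚ)) →
      galoisCohomology (W.torsionGaloisModule (((3 : ℕ) : ℤ) ^ k * ((3 : ℕ) : ℤ))) 1}
    (hg : g ∈ D.kolyvaginSystems (propagatedSelmerStructure W 3 k))
    (hgen : ∀ κ ∈ D.kolyvaginSystems (propagatedSelmerStructure W 3 k), ∃ a : ℕ, κ = a • g)
    {gt : Finset (HeightOneSpectrum (𝓞 ℚ)) →
      galoisCohomology (W.torsionGaloisModule (((3 : ℕ) : ℤ) ^ kt * ((3 : ℕ) : ℤ))) 1}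
    (hgt : gt ∈ Dt.kolyvaginSystems (propagatedSelmerStructure W 3 kt))
    -- the good core vertex `c`
    {c : Finset (HeightOneSpectrum (𝓞 ℚ))} (hct : Dt.IsLevel c)
    (hbij : Function.Bijective fun κ : D.kolyvaginSystems (propagatedSelmerStructure W 3 k) =>
      (⟨κ.1 c, ((KolyvaginDatum.mem_kolyvaginSystems_iff D _ κ.1).mp κ.2).mem_selmerGroup c
        (Set.Subset.trans hct hsub)⟩ : (D.atLevel (propagatedSelmerStructure W 3 k) c).selmerGroup))
    (hgc : addOrderOf (g c) = 3 ^ (k + 1)) (hgtc : addOrderOf (gt c) = 3 ^ (kt + 1)) :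
    ∃ w : ℤ, IsCoprime w 3 ∧ galoisCohomology.map red 1 (gt ∅) = w • g ∅ ∧
      ∃ y ∈ (propagatedSelmerStructure W 3 kt).selmerGroup, galoisCohomology.map red 1 y = g ∅ := by
  haveI : Fact (Nat.Prime 3) := ⟨Nat.prime_three⟩
  have hsurj : W.HasSurjectiveModNGaloisRep ((3 : ℕ) : ℤ) := by simpa using htower 1
  have hK : D.IsKolyvaginSystem (propagatedSelmerStructure W 3 k) g :=
    (KolyvaginDatum.mem_kolyvaginSystems_iff _ _ _).mp hg
  have hKt : Dt.IsKolyvaginSystem (propagatedSelmerStructure W 3 kt) gt :=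
    (KolyvaginDatum.mem_kolyvaginSystems_iff _ _ _).mp hgt
  -- (L-c): `red_*(g̃ c) = w • g c` by SURJECTIVITY of evaluation at `c`, and `3 ∤ w` by the orders
  have hmem : galoisCohomology.map red 1 (gt c) ∈ (D.atLevel (propagatedSelmerStructure W 3 k) c).selmerGroup :=
    map_red_mem_selmerGroup_atLevel W hkk red hred D Dt hT hTt (hKt.mem_selmerGroup c hct)
  obtain ⟨κ, hκ⟩ := hbij.2 ⟨_, hmem⟩
  obtain ⟨w, hw⟩ := hgen κ.1 κ.2
  have hcmpN : galoisCohomology.map red 1 (gt c) = w • g c := by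
    have h := congrArg Subtype.val hκ
    simp only at h
    rw [← h, hw, Pi.smul_apply]
  have hinjincl : Function.Injective
      (galoisCohomology.map (W.torsionInclusion (pow_mul_dvd_pow_mul hkk)) 1) :=
    map_torsionInclusion_injective W hkk (geomTorsion_eq_zero_of_fixed_of_surj W hsurj kt)
  have hw3 : ¬ 3 ∣ w :=
    Ledger.not_dvd_of_comp_eq_pow_nsmul (p := 3) (galoisCohomology.map _ 1) hinjincl
      (galoisCohomology.map red 1) (K₀ := k + 1) (r := kt - k) (Nat.succ_pos k) (gt c)
      (by rw [show k + 1 + (kt - k) = kt + 1 by omega]; exact hgtc)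
      (map_torsionInclusion_map_red W hkk red hred (gt c)) (g c) hgc w hcmpN
  have hwco : IsCoprime (w : ℤ) 3 :=
    Nat.isCoprime_iff_coprime.mpr ((Nat.Prime.coprime_iff_not_dvd Nat.prime_three).mpr hw3).symm
  have hcmp : galoisCohomology.map red 1 (gt c) = (w : ℤ) • g c := by rw [natCast_zsmul, hcmpN]
  -- (L-a): RIGIDITY at `c` on the Kolyvagin systems of the restricted datum ([S24] (1) pinned on the deep class)
  have hDr : ({ D with primes := Dt.primes } : KolyvaginDatum _).HasCanonicalComparison (3 ^ (k + 1)) η :=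
    KSRestrict.hasCanonicalComparison_restrictPrimes hD hsub
  obtain ⟨hfreer, -⟩ := kolyvaginSystems_freeRankOne_deep_of_pinned_of_towerSurj hS24 W hk hkk htower τ hτμ
    hτq inv₃ hperf₃ hsum₃ hcompl₃ hEP S hS h3S hbadS ({ D with primes := Dt.primes } : KolyvaginDatum _) η hPt
    hT hDr
  have hinj : ∀ s : Finset (HeightOneSpectrum (𝓞 ℚ)) →
        galoisCohomology (W.torsionGaloisModule (((3 : ℕ) : ℤ) ^ k * ((3 : ℕ) : ℤ))) 1,
      ({ D with primes := Dt.primes } : KolyvaginDatum _).IsKolyvaginSystem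
          (propagatedSelmerStructure W 3 k) s → s c = 0 → s ∅ = 0 := by
    intro s hs hs0
    have hgr := KSRestrict.mem_kolyvaginSystems_restrictPrimes hg hsub
    have hgo : addOrderOf ((fun d : Finset (HeightOneSpectrum (𝓞 ℚ)) =>
        if (↑d : Set (HeightOneSpectrum (𝓞 ℚ))) ⊆ Dt.primes then g d else 0) c) = 3 ^ (k + 1) := by
      rw [KSRestrict.restrictPrimes_apply_of_subset _ _ hct, hgc]
    have h := apply_eq_zero_of_free_of_fullOrder hfreer hgr hgo
      ((KolyvaginDatum.mem_kolyvaginSystems_iff _ _ _).mpr hs) hs0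
    rw [h, Pi.zero_apply]
  -- (L-b): the push-forward of `g̃` is a Kolyvagin system of the restricted datum (landed); liftability
  have hPS : ∀ q ∈ Dt.primes, (Sum.inr q : Place ℚ) ∉ S := fun q hq => by
    rw [hPt] at hq
    exact hq.1
  have hmap : ({ D with primes := Dt.primes } : KolyvaginDatum _).IsKolyvaginSystem
      (propagatedSelmerStructure W 3 k) fun d => galoisCohomology.map red 1 (gt d) :=
    isKolyvaginSystem_map_red_of_le W hkk red hred hS h3S hbadS (D := { D with primes := Dt.primes }) rfl
      (le_of_eq hPt) hPS hTt hT hDt hDr hKt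
  exact ⟨w, hwco, apply_empty_eq_zsmul_of_coreVertex W k kt red hsub hK hmap hinj hct hcmp,
    exists_lift_apply_empty_of_coreVertex W k kt red hsub hK hKt hmap hinj hct hwco hcmp⟩

end Summit.BirchSwinnertonDyer.BirchSwinnertonDyer.Theorems.KimAtThreeStubOfLiftable

end
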